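/-
Copyright (c) 2026. All rights reserved.
Released under Apache 2.0 license as described in the file LICENSE.
Authors: abc-iut cell, prover seat abc-iut-w5-d210 (wave 5, D-0068).
-/
import Literature.AnabelianGeometry.AbsoluteAnabelian.TMMonoNonVacuity
import Mathlib.Analysis.SpecialFunctions.Log.Basic
import HarnessLib

/-!
# [AbsTopIII] Definition 5.6 (i): in EVERY object `(C, C⃗)` of `TM⊢` the ray `C⃗` is "necessarily isomorphic to `ℝ_{≥0}`"

S. Mochizuki, *Topics in absolute anabelian geometry III: global reconstruction algorithms*,
J. Math. Sci. Univ. Tokyo 22 (2015) 939–1156 [MochizukiAbsTopIII2015], Def 5.6 (i) (manuscript p. 134): "a topological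
submonoid `C⃗ ⊆ C` [necessarily isomorphic to `ℝ_{≥0}`] such that the natural inclusions `C^× ↪ C`, `C⃗ ↪ C` determine an
isomorphism `C^× × C⃗ ⥲ C` of topological monoids".

PROOF-ONLY companion to the LANDED statement file `MonoAnalyticLogShells.lean` (typer abc-iut-L4-t3, `TMMono`; not edited):
the bracketed assertion "[necessarily isomorphic to `ℝ_{≥0}`]" is PROVED for every `M : TMMono` from the typed clauses
`exists_iso : C ≅ 𝒪_ℂ^▷` and `isHomeomorph_mul : C^× × C⃗ ≅ C` alone:
* `TMMono.eq_one_of_coe_units_mem_pos` — `C⃗ ∩ C^× = {1}` (injectivity of `C^× × C⃗ → C`);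
* `TMMono.nontrivial` — `C` is not a point (`C ≅ 𝒪_ℂ^▷ ∋ 1, 1/2`);
* `TMMono.exists_homeomorph_pos_Ioc` — `C⃗ ≅ (0, 1]` as topological monoids: `t ↦ ‖e(t)‖` is a multiplicative
  homeomorphism onto `(0, 1] ⊆ ℝ` (injective because two elements of `𝒪_ℂ^▷` of equal norm differ by a unit and
  `C^× × C⃗ → C` is injective; surjective with continuous inverse `r ↦ pr₂((C^× × C⃗ ≅ C)⁻¹(e⁻¹ r))`);
* `TMMono.exists_homeomorph_pos_nnreal` — `C⃗ ≅ ℝ_{≥0}` as topological monoids (`(0,1] ≅ (ℝ_{≥0}, +)` via `−log`),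
  the printed bracket verbatim.
Declares NO `def` / `instance` / `structure`. Classical complex analysis only; no named fact consumed or introduced.
Refereed pre-IUT anabelian geometry; nothing here bears on [IUTchIII] Cor. 3.12; typed ≠ proved elsewhere.
-/

set_option autoImplicit false

universe u

open Complex

namespace Literature.AnabelianGeometry.AbsoluteAnabelian

/-- In every object `(C, C⃗)` of `TM⊢`, `C⃗ ∩ C^× = {1}`: a unit of `C` lying on the ray `C⃗` is `1` (the map
`C^× × C⃗ → C`, `(u, t) ↦ u·t` is injective and `(u, 1) ↦ u`, `(1, u) ↦ u`).
[cite: MochizukiAbsTopIII2015, Def 5.6 (i) p. 134] -/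
theorem TMMono.eq_one_of_coe_units_mem_pos (M : TMMono.{u}) (u : M.Cˣ) (hu : (u : M.C) ∈ M.pos) : u = 1 := by
  have hinj := M.isHomeomorph_mul.injective
  have h : (fun x : M.Cˣ × M.pos => (x.1 : M.C) * (x.2 : M.C)) (u, 1) =
      (fun x : M.Cˣ × M.pos => (x.1 : M.C) * (x.2 : M.C)) (1, ⟨(u : M.C), hu⟩) := by
    simp
  exact (Prod.ext_iff.1 (hinj h)).1

/-- Every object `C` of `TM⊢` is nontrivial (`C ≅ 𝒪_ℂ^▷`, which contains `1 ≠ 1/2`).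
[cite: MochizukiAbsTopIII2015, Def 5.6 (i) p. 134] -/
theorem TMMono.nontrivial (M : TMMono.{u}) : Nontrivial M.C := by
  obtain ⟨e, -, -⟩ := M.exists_iso
  have h2 : ((1 / 2 : ℝ) : ℂ) ∈ complexIntegralMonoid :=
    ofReal_mem_complexIntegralMonoid (by norm_num) (by norm_num)
  refine ⟨⟨e.symm 1, e.symm ⟨_, h2⟩, fun h => ?_⟩⟩
  have h' := congrArg (fun x : complexIntegralMonoid => (x : ℂ)) (e.symm.injective h)
  simp only [Submonoid.coe_one] at h'
  have h'' := congrArg Complex.re h'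
  norm_num at h''

/-- **Def 5.6 (i), the bracket "[`C⃗` necessarily isomorphic to `ℝ_{≥0}`]", multiplicative form**: for every object
`(C, C⃗)` of `TM⊢` there is a homeomorphism `C⃗ ≅ (0, 1] ⊆ ℝ` carrying the monoid law of `C⃗` to multiplication
(namely `t ↦ ‖e(t)‖` for any `e : C ≅ 𝒪_ℂ^▷`; independent input: only the typed clauses of `TMMono`).
[cite: MochizukiAbsTopIII2015, Def 5.6 (i) p. 134] -/
theorem TMMono.exists_homeomorph_pos_Ioc (M : TMMono.{u}) :
    ∃ φ : M.pos ≃ₜ Set.Ioc (0 : ℝ) 1, (∀ s t : M.pos, (φ (s * t) : ℝ) = φ s * φ t) ∧ (φ 1 : ℝ) = 1 := by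
  classical
  obtain ⟨e, he, hes⟩ := M.exists_iso
  -- the homeomorphism `C^× × C⃗ ≅ C` and its inverse
  let H : M.Cˣ × M.pos ≃ₜ M.C := M.isHomeomorph_mul.homeomorph
  have H_apply : ∀ x : M.Cˣ × M.pos, H x = (x.1 : M.C) * (x.2 : M.C) := fun _ => rfl
  have hinj := M.isHomeomorph_mul.injective
  -- the candidate map `t ↦ ‖e t‖ ∈ (0, 1]`
  let φ : M.pos → Set.Ioc (0 : ℝ) 1 := fun t =>
    ⟨‖((e (t : M.C) : complexIntegralMonoid) : ℂ)‖,
      complexIntegralMonoid.norm_pos _, complexIntegralMonoid.norm_le_one _⟩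
  have φ_val : ∀ t : M.pos, (φ t : ℝ) = ‖((e (t : M.C) : complexIntegralMonoid) : ℂ)‖ := fun _ => rfl
  have hφc : Continuous φ :=
    Continuous.subtype_mk
      (continuous_norm.comp (continuous_subtype_val.comp (he.comp continuous_subtype_val))) _
  have hφmul : ∀ s t : M.pos, (φ (s * t) : ℝ) = φ s * φ t := by
    intro s t
    rw [φ_val, φ_val, φ_val, Submonoid.coe_mul, map_mul, Submonoid.coe_mul, norm_mul]
  -- the candidate inverse `r ↦ pr₂ (H⁻¹ (e⁻¹ r))`
  let ρ : Set.Ioc (0 : ℝ) 1 → complexIntegralMonoid := fun r =>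
    ⟨((r : ℝ) : ℂ), ofReal_mem_complexIntegralMonoid r.2.1 r.2.2⟩
  have hρc : Continuous ρ :=
    Continuous.subtype_mk (Complex.continuous_ofReal.comp continuous_subtype_val) _
  let ψ : Set.Ioc (0 : ℝ) 1 → M.pos := fun r => (H.symm (e.symm (ρ r))).2
  have hψc : Continuous ψ := continuous_snd.comp (H.symm.continuous.comp (hes.comp hρc))
  -- `φ ∘ ψ = id`: `e⁻¹ r = u · t` with `‖e u‖ = 1` forces `‖e t‖ = r`
  have hφψ : ∀ r, φ (ψ r) = r := by
    intro r
    have hdec : ((H.symm (e.symm (ρ r))).1 : M.C) * ((H.symm (e.symm (ρ r))).2 : M.C) = e.symm (ρ r) := by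
      rw [← H_apply, Homeomorph.apply_symm_apply]
    have hdec' : (e ((H.symm (e.symm (ρ r))).1 : M.C) : ℂ) * (e ((H.symm (e.symm (ρ r))).2 : M.C) : ℂ)
        = ((r : ℝ) : ℂ) := by
      rw [← Submonoid.coe_mul, ← map_mul, hdec, MulEquiv.apply_symm_apply]
    have hu : ‖((e ((H.symm (e.symm (ρ r))).1 : M.C) : complexIntegralMonoid) : ℂ)‖ = 1 :=
      complexIntegralMonoid.norm_coe_units (Units.map e.toMonoidHom (H.symm (e.symm (ρ r))).1)
    apply Subtype.ext
    rw [φ_val]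
    have := congrArg (fun z : ℂ => ‖z‖) hdec'
    simp only [norm_mul, hu, one_mul, Complex.norm_of_nonneg r.2.1.le] at this
    exact this
  -- `φ` is injective: equal norms in `𝒪_ℂ^▷` differ by a unit, and `C^× × C⃗ → C` is injective
  have hφinj : Function.Injective φ := by
    intro s t hst
    have hn : ‖((e (s : M.C) : complexIntegralMonoid) : ℂ)‖ = ‖((e (t : M.C) : complexIntegralMonoid) : ℂ)‖ := by
      rw [← φ_val, ← φ_val, hst]
    -- the unit `w = e s / e t` of `𝒪_ℂ^▷`
    have hs0 := complexIntegralMonoid.coe_ne_zero (e (s : M.C))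
    have ht0 := complexIntegralMonoid.coe_ne_zero (e (t : M.C))
    have hw : ((e (s : M.C) : complexIntegralMonoid) : ℂ) / ((e (t : M.C) : complexIntegralMonoid) : ℂ)
        ∈ complexIntegralMonoid := by
      rw [mem_complexIntegralMonoid_iff, norm_div, hn, div_self (norm_ne_zero_iff.2 ht0)]
      exact ⟨one_pos, le_rfl⟩
    have hw' : ((e (t : M.C) : complexIntegralMonoid) : ℂ) / ((e (s : M.C) : complexIntegralMonoid) : ℂ)
        ∈ complexIntegralMonoid := by
      rw [mem_complexIntegralMonoid_iff, norm_div, hn, div_self (norm_ne_zero_iff.2 ht0)]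
      exact ⟨one_pos, le_rfl⟩
    let W : (↥complexIntegralMonoid)ˣ :=
      ⟨⟨_, hw⟩, ⟨_, hw'⟩,
        Subtype.ext (by
          show ((e (s : M.C) : complexIntegralMonoid) : ℂ) / ((e (t : M.C) : complexIntegralMonoid) : ℂ) *
              (((e (t : M.C) : complexIntegralMonoid) : ℂ) / ((e (s : M.C) : complexIntegralMonoid) : ℂ)) = 1
          rw [div_mul_div_comm, mul_comm, div_self (mul_ne_zero ht0 hs0)]),
        Subtype.ext (by
          show ((e (t : M.C) : complexIntegralMonoid) : ℂ) / ((e (s : M.C) : complexIntegralMonoid) : ℂ) *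
              (((e (s : M.C) : complexIntegralMonoid) : ℂ) / ((e (t : M.C) : complexIntegralMonoid) : ℂ)) = 1
          rw [div_mul_div_comm, mul_comm, div_self (mul_ne_zero hs0 ht0)])⟩
    -- `e s = W · e t`, hence `s = e⁻¹(W) · t`
    have hWt : ((W : complexIntegralMonoid) * e (t : M.C) : complexIntegralMonoid) = e (s : M.C) := by
      apply Subtype.ext
      show ((e (s : M.C) : complexIntegralMonoid) : ℂ) / ((e (t : M.C) : complexIntegralMonoid) : ℂ) *
          ((e (t : M.C) : complexIntegralMonoid) : ℂ) = ((e (s : M.C) : complexIntegralMonoid) : ℂ)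
      exact div_mul_cancel₀ _ ht0
    let U : M.Cˣ := Units.map e.symm.toMonoidHom W
    have hU : (U : M.C) * (t : M.C) = (s : M.C) := by
      have := congrArg e.symm hWt
      rw [map_mul, MulEquiv.symm_apply_apply, MulEquiv.symm_apply_apply] at this
      exact this
    have hkey : (fun x : M.Cˣ × M.pos => (x.1 : M.C) * (x.2 : M.C)) (U, t) =
        (fun x : M.Cˣ × M.pos => (x.1 : M.C) * (x.2 : M.C)) (1, s) := by
      simp only [Units.val_one, one_mul]
      exact hU
    exact ((Prod.ext_iff.1 (hinj hkey)).2).symm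
  -- `ψ ∘ φ = id` from injectivity
  have hψφ : ∀ t, ψ (φ t) = t := fun t => hφinj (hφψ (φ t))
  refine ⟨⟨⟨φ, ψ, hψφ, hφψ⟩, hφc, hψc⟩, hφmul, ?_⟩
  -- `φ 1 = ‖e 1‖ = 1`
  show ‖((e ((1 : M.pos) : M.C) : complexIntegralMonoid) : ℂ)‖ = 1
  rw [Submonoid.coe_one, map_one, Submonoid.coe_one, norm_one]

/-- **Def 5.6 (i), the bracket "[`C⃗` necessarily isomorphic to `ℝ_{≥0}`]" VERBATIM**: for every object `(C, C⃗)` of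
`TM⊢` there is a homeomorphism `C⃗ ≅ ℝ_{≥0}` carrying the monoid law of `C⃗` to ADDITION and `1 ↦ 0` (compose the
multiplicative form `C⃗ ≅ (0, 1]` with `−log : (0, 1] ≅ ℝ_{≥0}`). [cite: MochizukiAbsTopIII2015, Def 5.6 (i) p. 134] -/
theorem TMMono.exists_homeomorph_pos_nnreal (M : TMMono.{u}) :
    ∃ ψ : M.pos ≃ₜ NNReal, (∀ s t : M.pos, ψ (s * t) = ψ s + ψ t) ∧ ψ 1 = 0 := by
  obtain ⟨φ, hφmul, hφone⟩ := M.exists_homeomorph_pos_Ioc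
  -- `−log : (0, 1] ≅ ℝ_{≥0}` with inverse `x ↦ exp (−x)`
  let L : Set.Ioc (0 : ℝ) 1 → NNReal := fun r =>
    ⟨-Real.log r, neg_nonneg.2 (Real.log_nonpos r.2.1.le r.2.2)⟩
  let E : NNReal → Set.Ioc (0 : ℝ) 1 := fun x =>
    ⟨Real.exp (-(x : ℝ)), Real.exp_pos _, by rw [Real.exp_le_one_iff, neg_nonpos]; exact x.2⟩
  have hLc : Continuous L :=
    Continuous.subtype_mk ((continuous_subtype_val.log fun r => r.2.1.ne').neg) _
  have hEc : Continuous E :=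
    Continuous.subtype_mk (Real.continuous_exp.comp continuous_subtype_val.neg) _
  have hLE : ∀ x, L (E x) = x := by
    intro x
    apply Subtype.ext
    show -Real.log (Real.exp (-(x : ℝ))) = x
    rw [Real.log_exp, neg_neg]
  have hEL : ∀ r, E (L r) = r := by
    intro r
    apply Subtype.ext
    show Real.exp (-(-Real.log (r : ℝ))) = r
    rw [neg_neg, Real.exp_log r.2.1]
  let Λ : Set.Ioc (0 : ℝ) 1 ≃ₜ NNReal := ⟨⟨L, E, hEL, hLE⟩, hLc, hEc⟩
  refine ⟨φ.trans Λ, fun s t => ?_, ?_⟩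
  · apply Subtype.ext
    show -Real.log (φ (s * t) : ℝ) = -Real.log (φ s : ℝ) + -Real.log (φ t : ℝ)
    rw [hφmul, Real.log_mul (φ s).2.1.ne' (φ t).2.1.ne', neg_add]
  · apply Subtype.ext
    show -Real.log (φ 1 : ℝ) = 0
    rw [hφone, Real.log_one, neg_zero]

end Literature.AnabelianGeometry.AbsoluteAnabelian
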